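import Summits.Langlands.Langlands.Theses.NonParallelVoid
import Literature.NumberTheory.GaloisRepresentations.ModPGaloisRep
import Literature.NumberTheory.GaloisRepresentations.AbsGaloisOuterConj
import Literature.NumberTheory.GaloisRepresentations.LocalGaloisGroup
import Literature.NumberTheory.PAdicHodge.FontaineDpst
import Literature.NumberTheory.GaloisRepresentations.DecompositionGroupOfCompletion
import Literature.NumberTheory.Automorphic.AdicCompletionResidueCard
import Summits.Langlands.Langlands.Theorems.NonParallelVoidResidueParallelStubInertFrobeniusTransportAlgebra
import Summits.Langlands.Langlands.Theorems.NonParallelVoidResidueParallelStubInertFrobeniusTransportEmbedding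

/-!
# Stub `stub_inertFrobeniusTransport` (line `inert-fl-transfer`, crux `ResidueParallel`,
stmt-Langlands-17003)

**Base change at an inert prime transports the local inertia group to itself and acts on Serre's
fundamental characters by an odd power of `p`.**  Let `F/ℚ` be quadratic, `p` a prime with a
unique place `v` of `F` above it, `e(v|p) = 1`, `f(v|p) = 2`, `p` a uniformiser of `F_v`,
`τ ∈ Γ_ℚ ∖ res(Γ_F)` and `θ_τ = absGaloisOuterConj ℚ F τ` (`σ ↦ res⁻¹(τ res σ τ⁻¹)`).  Then there
are `g ∈ Γ_F` and an ODD `j` such that every `σ` in the local inertia group `I_{F_v}` has a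
`σ' ∈ I_{F_v}` with `res_v σ' = g⁻¹ θ_τ(res_v σ) g` and `ψ_m(σ') = ψ_m(σ)^{p^j}` for the
fundamental characters `ψ_m = fundamentalCharacter F_v m ι p _` of levels `m = 1, 2` and every
residue embedding `ι`.

Proof.  (1) Transport of inertia, verbatim the `v = w` case of
`Summit.Langlands.Langlands.Cruxes.EmptyWeightCore.LocalClauseCut.stub_inertiaTransport`: with
`𝔓_v = adicCompletionPrime F v`, `τ ⋆ 𝔓_v` lies above `τ̄ • v = v` (uniqueness of `v`), so
`τ ⋆ 𝔓_v = g • 𝔓_v` for some `g ∈ Γ_F`; `I_{𝔓_v} = res_v(I_{F_v})`, `θ_τ(I_𝔔) = I_{τ ⋆ 𝔔}`,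
`I_{g • 𝔓} = g I_𝔓 g⁻¹`.  (2) Frobenius power.  Read everything in `\bar ℚ` through the chosen
embeddings `\bar ℚ → \bar F → \bar F_v`: the chosen root `z` of `z ^ (q^m - 1) = p` in `\bar F_v` is
the image of some `z₁ ∈ \bar ℤ_ℚ` (roots of a polynomial over `F` lie in the image,
`mem_range_of_aeval_eq_zero`), `Γ_{F_v}` acts on such images through `R ∘ res_v`
(`R = absGaloisRestrict ℚ F`, `absGaloisRestrict_apply_smul`), the canonical prime of `\bar F_v`
pulls back to `𝔓₁ = ι⁻¹ 𝔓_v ⊂ \bar ℤ_ℚ` (both are open unit balls of the spectral norm,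
`inertFrob_emb_mem_absMaximalIdeal_iff`), and `R(res_v σ') = h S h⁻¹`
with `S = R(res_v σ) ∈ I_{𝔓₁}`, `h = R(g)⁻¹ τ`, `h • 𝔓₁ = 𝔓₁`.  The Kummer cocycle of `σ'` is then
`h((S ζ / ζ)(S z₁ / z₁))` for the root of unity `ζ = h⁻¹ z₁ / z₁` (`inertFrob_conj_smul_div`), with
`S ζ / ζ ≡ 1 (mod 𝔓₁)` (`S` inertial), and `h` acts on the roots of unity of order dividing
`p ^ 4 - 1` modulo `𝔓₁` as `x ↦ x^{p^j}` (automorphisms of finite fields are Frobenius powers,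
`inertFrob_exists_odd_exponent`) with `j` odd because `h|_F = τ̄ ≠ 1` moves `𝓞 F / v ≅ 𝔽_{p²}`
(the inertia group of `v` in `Gal(F/ℚ)` has order `e(v|p) = 1`, Mathlib
`Ideal.card_inertia_eq_ramificationIdxIn`).

References: J. Neukirch, *Algebraic Number Theory* (1999), Ch. I §9 (9.1)–(9.4), Ch. II §9
Prop. (9.6); J.-P. Serre, Invent. Math. 15 (1972), §1.7 Prop. 3 (fundamental characters; Galois
conjugation acts through Frobenius powers).  General algebra (finite fields, the cocycle identity)
is in `…StubInertFrobeniusTransportAlgebra.lean`, the embedding bookkeeping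
`\bar ℚ → \bar F → \bar F_v` in `…StubInertFrobeniusTransportEmbedding.lean`.  No `sorry`, no new
definitions.
-/

-- project-wide option (lakefile weak.linter.dupNamespace); `Summit.Langlands.Langlands` is mandated
set_option linter.dupNamespace false

noncomputable section

open scoped NumberField Pointwise
open Literature.NumberTheory.GaloisRepresentations Literature.NumberTheory.PAdicHodge
open Literature.NumberTheory.GaloisRepresentations.IsNonarchimedeanLocalField (residueFieldCard absMaximalIdeal)
open Field IsDedekindDomain NumberField ValuativeRel Polynomial

namespace Summit.Langlands.Langlands.Cruxes.ResidueParallel.InertFLTransfer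

/-! ### The Kummer cocycle of a conjugate, read in `\bar ℚ` -/

section KummerTransport

variable (F : Type) [Field F] [NumberField F] (v : HeightOneSpectrum (𝓞 F))

/-- **Galois transport of the local Kummer cocycle.**  Let `z` be the chosen root of `z ^ n = p` in
`\bar F_v` (`kummerRoot`), `𝔓₁ = ι⁻¹ 𝔓_v ⊂ \bar ℤ_ℚ`, `γ, S ∈ Γ_ℚ` with `S ∈ I_{𝔓₁}` and `γ` acting
on the `n`-th roots of unity modulo `𝔓₁` as `x ↦ x ^ e`.  If `σ, σ' ∈ Γ_{F_v}` restrict to `S` and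
`γ S γ⁻¹` in `Γ_ℚ`, then the Kummer cocycles satisfy `σ'(z)/z ≡ (σ(z)/z) ^ e` modulo the prime of
`\bar F_v`: `z = ι(z₁)` with `z₁ ∈ \bar ℤ_ℚ` (`inertFrob_exists_preimage`),
`σ'(z)/z = ι(γ((S ζ/ζ)(S z₁/z₁)))` for `ζ = γ⁻¹ z₁ / z₁` (`inertFrob_conj_smul_div`),
`S ζ / ζ ≡ 1 (mod 𝔓₁)` and `γ(S z₁/z₁) ≡ (S z₁/z₁) ^ e`; the prime of `\bar F_v` pulls back to `𝔓₁`
(`mem_radical_map_maximalIdeal_iff`, `mem_adicCompletionPrime_iff`).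
[cite: SerreInventiones1972, §1.7 Prop. 3] -/
theorem inertFrob_kummerCocycleInt_sub_pow_mem (p : ℕ) {n : ℕ} (hn : 0 < n)
    (hp0 : ((p : ℕ) : 𝒪[v.adicCompletion F]) ≠ 0) (γ S : absoluteGaloisGroup ℚ) (e : ℕ)
    (hfrob : ∀ x : absIntegers (𝓞 ℚ) ℚ, x ^ n = 1 →
      γ • x - x ^ e ∈ (adicCompletionPrime F v).comap (absIntegersMap ℚ F))
    (hS : S ∈ ((adicCompletionPrime F v).comap (absIntegersMap ℚ F)).inertia (absoluteGaloisGroup ℚ))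
    (σ σ' : absoluteGaloisGroup (v.adicCompletion F))
    (hσ : absGaloisRestrict ℚ F (absGaloisRestrict F (v.adicCompletion F) σ) = S)
    (hσ' : absGaloisRestrict ℚ F (absGaloisRestrict F (v.adicCompletion F) σ') = γ * S * γ⁻¹) :
    kummerCocycleInt (v.adicCompletion F) hn hp0 σ' -
        kummerCocycleInt (v.adicCompletion F) hn hp0 σ ^ e ∈
      absMaximalIdeal (v.adicCompletion F) := by
  -- `ι : \bar ℤ_ℚ → \bar 𝒪_{F_v}` and the pull-back of the prime of `\bar F_v`
  let jInt : absIntegers (𝓞 ℚ) ℚ →+* absIntegers 𝒪[v.adicCompletion F] (v.adicCompletion F) :=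
    ((((absClosureEmbedding F (v.adicCompletion F)).toRingHom.comp
      (absIntegers (𝓞 F) F).val.toRingHom).comp (absIntegersMap ℚ F)).codRestrict
      (absIntegers 𝒪[v.adicCompletion F] (v.adicCompletion F)))
      fun s => inertFrob_absClosureEmbedding_mem F v s
  have hjcoe : ∀ s : absIntegers (𝓞 ℚ) ℚ,
      ((jInt s : absIntegers 𝒪[v.adicCompletion F] (v.adicCompletion F)) :
          AlgebraicClosure (v.adicCompletion F)) =
        absClosureEmbedding F (v.adicCompletion F) (absClosureEmbedding ℚ F (s : AlgebraicClosure ℚ)) :=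
    fun s ↦ rfl
  have hjmem : ∀ s : absIntegers (𝓞 ℚ) ℚ, jInt s ∈ absMaximalIdeal (v.adicCompletion F) ↔
      s ∈ (adicCompletionPrime F v).comap (absIntegersMap ℚ F) := fun s ↦
    inertFrob_emb_mem_absMaximalIdeal_iff F v s
  -- the chosen root `z` of `z ^ n = p` in `\bar F_v` comes from `z₁ ∈ \bar ℚ`
  obtain ⟨z₁, hz₁, hz₁n⟩ := inertFrob_exists_preimage F v hn p
    (kummerRoot (v.adicCompletion F) hn ((p : ℕ) : 𝒪[v.adicCompletion F]) :
      AlgebraicClosure (v.adicCompletion F))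
    (by rw [coe_kummerRoot_pow, map_natCast])
  have hz₁0 : z₁ ≠ 0 := by
    rintro rfl
    rw [map_zero, map_zero] at hz₁
    exact coe_kummerRoot_ne_zero hn hp0 hz₁.symm
  have esmul : ∀ (g : absoluteGaloisGroup ℚ) (k : ℕ), g • (k : AlgebraicClosure ℚ) = k := fun g k ↦ by
    have := map_natCast (MulSemiringAction.toRingHom (absoluteGaloisGroup ℚ) (AlgebraicClosure ℚ) g) k
    rwa [MulSemiringAction.toRingHom_apply] at this
  have hpne : (p : AlgebraicClosure ℚ) ≠ 0 := by
    rw [← hz₁n]; exact pow_ne_zero _ hz₁0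
  -- `γ⁻¹ z₁ = ζ z₁`
  obtain ⟨ζ, hζdef⟩ : ∃ ζ : AlgebraicClosure ℚ, ζ = γ⁻¹ • z₁ / z₁ := ⟨_, rfl⟩
  have hζ : γ⁻¹ • z₁ = ζ * z₁ := by rw [hζdef, div_mul_cancel₀ _ hz₁0]
  have hζ0 : ζ ≠ 0 := by
    intro h0
    rw [h0, zero_mul, smul_eq_zero_iff_eq] at hζ
    exact hz₁0 hζ
  -- the roots of unity `c = S z₁ / z₁`, `ζ`, `d = S ζ / ζ`
  have hcn : (S • z₁ / z₁) ^ n = 1 := by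
    rw [div_pow, ← smul_pow', hz₁n, esmul, div_self hpne]
  have hζn : ζ ^ n = 1 := by
    rw [hζdef, div_pow, ← smul_pow', hz₁n, esmul, div_self hpne]
  have hdn : (S • ζ / ζ) ^ n = 1 := by
    rw [div_pow, ← smul_pow', hζn, smul_one, div_one]
  have hconjz : (γ * S * γ⁻¹) • z₁ / z₁ = γ • (S • ζ / ζ * (S • z₁ / z₁)) :=
    inertFrob_conj_smul_div γ S hz₁0 hζ
  have hint : ∀ x : AlgebraicClosure ℚ, x ^ n = 1 → IsIntegral (𝓞 ℚ) x := fun x hx ↦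
    IsIntegral.of_pow hn (by rw [hx]; exact isIntegral_one)
  obtain ⟨C, hCval⟩ : ∃ C : absIntegers (𝓞 ℚ) ℚ, (C : AlgebraicClosure ℚ) = S • z₁ / z₁ :=
    ⟨⟨_, hint _ hcn⟩, rfl⟩
  obtain ⟨D, hDval⟩ : ∃ D : absIntegers (𝓞 ℚ) ℚ, (D : AlgebraicClosure ℚ) = S • ζ / ζ :=
    ⟨⟨_, hint _ hdn⟩, rfl⟩
  obtain ⟨Z, hZval⟩ : ∃ Z : absIntegers (𝓞 ℚ) ℚ, (Z : AlgebraicClosure ℚ) = ζ :=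
    ⟨⟨_, hint _ hζn⟩, rfl⟩
  have hC : C ^ n = 1 := Subtype.ext (by rw [Subalgebra.coe_pow, hCval, hcn, OneMemClass.coe_one])
  have hD : D ^ n = 1 := Subtype.ext (by rw [Subalgebra.coe_pow, hDval, hdn, OneMemClass.coe_one])
  have hZ : Z ^ n = 1 := Subtype.ext (by rw [Subalgebra.coe_pow, hZval, hζn, OneMemClass.coe_one])
  -- `d ≡ 1 (mod 𝔓₁)`: `S` is inertial and `ζ` is a unit
  have hD1 : D - 1 ∈ (adicCompletionPrime F v).comap (absIntegersMap ℚ F) := by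
    rw [← Ideal.mul_unit_mem_iff_mem _ (IsUnit.of_pow_eq_one hZ hn.ne')]
    have : (D - 1) * Z = S • Z - Z := by
      apply Subtype.ext
      rw [Subalgebra.coe_mul, Subalgebra.coe_sub, OneMemClass.coe_one, Subalgebra.coe_sub,
        integralClosure.coe_smul, hDval, hZval, sub_mul, div_mul_cancel₀ _ hζ0, one_mul]
    rw [this]
    exact hS Z
  -- the congruence in `\bar ℤ_ℚ`, transported to `\bar F_v`
  have hmain := (hjmem _).2 (inertFrob_smul_sub_pow_mem _ γ hfrob hC hD hD1)
  rw [map_sub, map_pow] at hmain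
  -- identify the two cocycles
  have hcoc : kummerCocycleInt (v.adicCompletion F) hn hp0 σ = jInt C := by
    apply Subtype.ext
    rw [coe_kummerCocycleInt, kummerCocycle, hjcoe, hCval, ← hz₁, inertFrob_smul_emb, hσ,
      map_div₀, map_div₀]
  have hcoc' : kummerCocycleInt (v.adicCompletion F) hn hp0 σ' = jInt (γ • (D * C)) := by
    apply Subtype.ext
    rw [coe_kummerCocycleInt, kummerCocycle, hjcoe, integralClosure.coe_smul,
      Subalgebra.coe_mul, hDval, hCval, ← hconjz, ← hz₁, inertFrob_smul_emb, hσ', map_div₀,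
      map_div₀]
  rw [hcoc, hcoc']
  exact hmain

end KummerTransport

/-! ### The stub -/

set_option synthInstance.maxHeartbeats 100000 in
-- the pointwise `MulAction` of `Γ_ℚ` on the ideals of the subalgebra `\bar ℤ_ℚ` is slow to find
/-- **STUB 3d — `inertFrobeniusTransport`.**  Base change at an INERT prime transports the local
inertia group to itself and acts on the fundamental characters by an ODD power of `p`: for `F/ℚ`
quadratic, `τ ∈ Γ_ℚ ∖ res Γ_F`, `v` the unique place above `p`, unramified with `f(v|p) = 2`, `p` a
uniformiser of `F_v`, there are `g ∈ Γ_F` and an odd `j` such that every `σ ∈ I_{F_v}` has a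
`σ' ∈ I_{F_v}` with `res_v σ' = g⁻¹ θ_τ(res_v σ) g` and `ψ_m(σ') = ψ_m(σ)^{p^j}` for the fundamental
characters `ψ_m = fundamentalCharacter F_v m ι p _` of levels `m = 1, 2` (relative to `q = p²`) and
every residue embedding `ι`.  Transport of inertia: `τ ⋆ 𝔓_v = g • 𝔓_v`
(`outerConjIdeal_mem_primesAbove`, `exists_smul_eq_of_mem_primesAbove_holds`),
`I_{𝔓_v} = res_v I_{F_v}` (`inertia_adicCompletionPrime_eq_map_absInertia`),
`absGaloisOuterConj_mem_inertia_iff`, `Ideal.conj_mem_inertia_smul_iff`.  Power law: for the root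
`z₁ ∈ \bar ℚ` of `z₁^{p^{2m}−1} = p` under the chosen root in `\bar F_v`, `h := R(g)⁻¹ τ` gives
`(hSh⁻¹) z₁ / z₁ = h((Sζ/ζ)(S z₁/z₁))` (`inertFrob_kummerCocycleInt_sub_pow_mem`), and `h` acts on
the residue field at `𝔓₁ = ι⁻¹ 𝔓_v` as `x ↦ x^{p^j}` on `𝔽_{p⁴}` with `j` odd because `h|_F = τ̄`
acts non-trivially on `𝓞 F / v = 𝔽_{p²}` (`e(v|p) = 1`; `inertFrob_exists_odd_exponent`,
`inertFrob_exists_smul_sub_not_mem`).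
[cite: NeukirchANT1999, Ch. I §9 (9.1)–(9.4) and Ch. II §9 Prop. (9.6)] [cite: SerreInventiones1972, §1.7 Prop. 3] -/
theorem stub_inertFrobeniusTransport :
    ∀ (F : Type) [Field F] [NumberField F] [Algebra.IsQuadraticExtension ℚ F] (p : ℕ) [Fact p.Prime]
      (τ : absoluteGaloisGroup ℚ), τ ∉ Set.range (absGaloisRestrict ℚ F) →
      ∀ (v : IsDedekindDomain.HeightOneSpectrum (NumberField.RingOfIntegers F)),
        ((p : ℕ) : NumberField.RingOfIntegers F) ∈ v.asIdeal →
        (∀ w : IsDedekindDomain.HeightOneSpectrum (NumberField.RingOfIntegers F),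
            ((p : ℕ) : NumberField.RingOfIntegers F) ∈ w.asIdeal → w = v) →
        v.asIdeal.ramificationIdx ℤ = 1 → v.asIdeal.inertiaDeg ℤ = 2 →
        ∀ (hϖ : Irreducible ((p : ℕ) : 𝒪[v.adicCompletion F])),
        ∃ (g : absoluteGaloisGroup F) (j : ℕ), Odd j ∧
          ∀ σ ∈ absInertia (v.adicCompletion F), ∃ (σ' : absoluteGaloisGroup (v.adicCompletion F))
            (hσ' : σ' ∈ absInertia (v.adicCompletion F)),
            absGaloisRestrict F (v.adicCompletion F) σ' =
              g⁻¹ * absGaloisOuterConj ℚ F τ (absGaloisRestrict F (v.adicCompletion F) σ) * g ∧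
            ∀ (m : ℕ), (m = 1 ∨ m = 2) →
              ∀ (ι : absIntegers 𝒪[v.adicCompletion F] (v.adicCompletion F) ⧸
                  absMaximalIdeal (v.adicCompletion F) →+* padicAlgClResidueField p)
                (hσ : σ ∈ absInertia (v.adicCompletion F)),
                fundamentalCharacter (v.adicCompletion F) m ι ((p : ℕ) : 𝒪[v.adicCompletion F]) hϖ ⟨σ', hσ'⟩ =
                  fundamentalCharacter (v.adicCompletion F) m ι ((p : ℕ) : 𝒪[v.adicCompletion F]) hϖ ⟨σ, hσ⟩ ^ (p ^ j) := by
  intro F _ _ _ p _ τ hτ v hv huniq he hf hϖ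
  have hp : Prime (p : ℤ) := Nat.prime_iff_prime_int.mp Fact.out
  haveI hLies : v.asIdeal.LiesOver (Ideal.span {(p : ℤ)}) :=
    (Ideal.liesOver_span_iff v.isPrime.ne_top hp).2 (by simpa using hv)
  -- residue cardinality `q = p ^ 2`
  have hq : residueFieldCard (v.adicCompletion F) = p ^ 2 := by
    rw [Literature.NumberTheory.Automorphic.residueFieldCard_adicCompletion_eq,
      HeightOneSpectrum.residueCard, ← hf]
    haveI := v.isPrime
    exact (Ideal.pow_inertiaDeg p v.asIdeal).symm
  -- the prime `𝔓_v`, `τ̄ • v = v`, and `g` with `g • 𝔓_v = τ ⋆ 𝔓_v`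
  have h𝔓v := adicCompletionPrime_mem_primesAbove F v
  have hτv : absGaloisQuot ℚ F τ • v = v := by
    apply huniq
    have h1 := (Literature.NumberTheory.Automorphic.HeightOneSpectrum.smul_mem_smul_asIdeal_iff
      (absGaloisQuot ℚ F τ) v ((p : ℕ) : 𝓞 F)).2 hv
    have h2 := map_natCast (MulSemiringAction.toRingHom (F ≃ₐ[ℚ] F) (𝓞 F) (absGaloisQuot ℚ F τ)) p
    rw [MulSemiringAction.toRingHom_apply] at h2
    rwa [h2] at h1
  have hconj : outerConjIdeal τ (adicCompletionPrime F v) ∈ v.primesAbove := by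
    have h := outerConjIdeal_mem_primesAbove h𝔓v τ
    rwa [hτv] at h
  obtain ⟨g, hg⟩ := HeightOneSpectrum.exists_smul_eq_of_mem_primesAbove_holds h𝔓v hconj
  -- `h = R(g)⁻¹ τ` stabilises the prime `𝔓₁ = ι⁻¹ 𝔓_v` of `\bar ℤ_ℚ`
  have hstab : ((absGaloisRestrict ℚ F g)⁻¹ * τ) • (adicCompletionPrime F v).comap (absIntegersMap ℚ F) =
      (adicCompletionPrime F v).comap (absIntegersMap ℚ F) := by
    have key : absGaloisRestrict ℚ F g • (adicCompletionPrime F v).comap (absIntegersMap ℚ F) =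
        τ • (adicCompletionPrime F v).comap (absIntegersMap ℚ F) := by
      rw [← comap_absIntegersMap_smul, hg, comap_outerConjIdeal]
    rw [mul_smul, ← key, inv_smul_smul]
  haveI : (adicCompletionPrime F v).IsMaximal := adicCompletionPrime_isMaximal F v
  haveI h𝔓1max : ((adicCompletionPrime F v).comap (absIntegersMap ℚ F)).IsMaximal :=
    Ideal.comap_isMaximal_of_surjective _ (absIntegersMap_surjective ℚ F)
  have hp1 : ((p : ℕ) : absIntegers (𝓞 ℚ) ℚ) ∈ (adicCompletionPrime F v).comap (absIntegersMap ℚ F) := by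
    have := (inertFrob_absEmbeddingInt_mem_iff F v ((p : ℕ) : 𝓞 F)).2 hv
    rwa [map_natCast] at this
  -- `h|_F = τ̄ ≠ 1` moves `𝓞 F / v`: the odd exponent `j`
  have hτ1 : absGaloisQuot ℚ F τ ≠ 1 := fun h1 ↦ by
    obtain ⟨g', hg'⟩ := (absGaloisQuot_eq_one_iff ℚ F τ).1 h1
    exact hτ ⟨g', hg'⟩
  obtain ⟨y, hy⟩ := inertFrob_exists_smul_sub_not_mem p v hv he (absGaloisQuot ℚ F τ) hτ1
  have hy1 : (absEmbeddingInt ℚ F y) ^ (p ^ 2) - absEmbeddingInt ℚ F y ∈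
      (adicCompletionPrime F v).comap (absIntegersMap ℚ F) := by
    rw [← map_pow, ← map_sub]
    exact (inertFrob_absEmbeddingInt_mem_iff F v _).2 (inertFrob_pow_sq_sub_mem p v hv hf y)
  have hy2 : ((absGaloisRestrict ℚ F g)⁻¹ * τ) • absEmbeddingInt ℚ F y - absEmbeddingInt ℚ F y ∉
      (adicCompletionPrime F v).comap (absIntegersMap ℚ F) := by
    rw [smul_absEmbeddingInt, map_mul, map_inv, absGaloisQuot_absGaloisRestrict, inv_one,
      one_mul, ← map_sub, inertFrob_absEmbeddingInt_mem_iff]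
    exact hy
  obtain ⟨j, hjodd, hj⟩ := inertFrob_exists_odd_exponent _ p hp1 _ hstab hy1 hy2
  refine ⟨g, j, hjodd, fun σ hσ ↦ ?_⟩
  -- transport of inertia (the `v = w` case of the split template)
  have h1 : absGaloisRestrict F (v.adicCompletion F) σ ∈
      (adicCompletionPrime F v).inertia (absoluteGaloisGroup F) := by
    rw [inertia_adicCompletionPrime_eq_map_absInertia]
    exact ⟨σ, hσ, rfl⟩
  have h2 : absGaloisOuterConj ℚ F τ (absGaloisRestrict F (v.adicCompletion F) σ) ∈
      (g • adicCompletionPrime F v).inertia (absoluteGaloisGroup F) := by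
    rw [hg]
    exact (absGaloisOuterConj_mem_inertia_iff τ (adicCompletionPrime F v) _).2 h1
  have h3 : g⁻¹ * absGaloisOuterConj ℚ F τ (absGaloisRestrict F (v.adicCompletion F) σ) * g ∈
      (adicCompletionPrime F v).inertia (absoluteGaloisGroup F) :=
    (Ideal.conj_mem_inertia_smul_iff (adicCompletionPrime F v) g _).1 (by simpa [mul_assoc] using h2)
  rw [inertia_adicCompletionPrime_eq_map_absInertia, Subgroup.mem_map] at h3
  obtain ⟨σ', hσ', hres⟩ := h3
  refine ⟨σ', hσ', hres, fun m hm ι hσI ↦ ?_⟩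
  -- the Frobenius power law on the fundamental characters
  have hm0 : m ≠ 0 := by rintro rfl; simp at hm
  have hSS' : absGaloisRestrict ℚ F (absGaloisRestrict F (v.adicCompletion F) σ') =
      ((absGaloisRestrict ℚ F g)⁻¹ * τ) *
        absGaloisRestrict ℚ F (absGaloisRestrict F (v.adicCompletion F) σ) *
          ((absGaloisRestrict ℚ F g)⁻¹ * τ)⁻¹ := by
    have hres' : absGaloisRestrict F (v.adicCompletion F) σ' =
        g⁻¹ * absGaloisOuterConj ℚ F τ (absGaloisRestrict F (v.adicCompletion F) σ) * g := hres
    rw [hres', map_mul, map_mul, map_inv, absGaloisRestrict_absGaloisOuterConj]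
    group
  have hSSI : absGaloisRestrict ℚ F (absGaloisRestrict F (v.adicCompletion F) σ) ∈
      ((adicCompletionPrime F v).comap (absIntegersMap ℚ F)).inertia (absoluteGaloisGroup ℚ) :=
    absGaloisRestrict_mem_inertia_comap ℚ F h1
  have hn4 : residueFieldCard (v.adicCompletion F) ^ m - 1 ∣ p ^ 4 - 1 := by
    rw [hq]
    rcases hm with rfl | rfl
    · have := Nat.sub_dvd_pow_sub_pow (p ^ 2) 1 2
      rw [one_pow, ← pow_mul] at this
      simpa using this
    · rw [← pow_mul]
  have hfrob : ∀ x : absIntegers (𝓞 ℚ) ℚ, x ^ (residueFieldCard (v.adicCompletion F) ^ m - 1) = 1 →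
      ((absGaloisRestrict ℚ F g)⁻¹ * τ) • x - x ^ (p ^ j) ∈
        (adicCompletionPrime F v).comap (absIntegersMap ℚ F) := by
    intro x hx
    apply hj
    obtain ⟨k, hk⟩ := hn4
    have h4 : 1 ≤ p ^ 4 := Nat.one_le_pow _ _ (Fact.out : p.Prime).pos
    have : p ^ 4 = (residueFieldCard (v.adicCompletion F) ^ m - 1) * k + 1 := by
      rw [← hk, Nat.sub_add_cancel h4]
    rw [this, pow_succ, pow_mul, hx, one_pow, one_mul, sub_self]
    exact zero_mem _
  rw [fundamentalCharacter_of_ne_zero _ hm0]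
  ext
  rw [Units.val_pow_eq_pow_val, coe_kummerCharacter_apply, coe_kummerCharacter_apply, ← map_pow,
    ← map_pow]
  congr 1
  rw [Ideal.Quotient.eq]
  exact inertFrob_kummerCocycleInt_sub_pow_mem F v p _ hϖ.ne_zero _ _ (p ^ j) hfrob hSSI σ σ' rfl hSS'

end Summit.Langlands.Langlands.Cruxes.ResidueParallel.InertFLTransfer

end
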